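/-
Copyright (c) 2026. All rights reserved.
Released under Apache 2.0 license as described in the file LICENSE.
-/
import Summits.KontsevichZagierPeriods.KontsevichZagierPeriods.Theorems.SoloInformedStuffleReps
import Summits.KontsevichZagierPeriods.KontsevichZagierPeriods.Theorems.SoloInformedShuffleProduct

/-!
# PROGRAMME XLI, file 3 — THEOREM XLI: the stuffle `ζ(a)ζ(b) = ζ(a,b) + ζ(b,a) + ζ(a+b)` in `𝒫`

For all `a, b ≥ 2` (written `a = p+2`, `b = q+2`), in `KZ.FormalPeriodRing`

  `mzvClass [a] * mzvClass [b] = mzvClass [a, b] + mzvClass [b, a] + mzvClass [a + b]`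

(`soloInformed_mzvClass_stuffle`).  The chain of moves, every one an instance of the three naive
Kontsevich–Zagier rules:

* Fubini (the product of `𝒫`): `[CubeZ p]·[CubeZ q] = [cube^{a} × cube^{b}, 1/((1−X)(1−Y))]`, read
  in dimension `p+q+4` through the relabelling `Fin (a+b) ≃ Fin (p+q+4)` (rule (2)); the cut is
  `K = a − 1`, `X = X_K`, `Y = Y_K`;
* rule (1b), `1 − XY = (1 − X) + X(1 − Y)`: `= [CutQ K] + [CutC K]`, and `⟦CutQ K⟧ = Z(a, b)`;
* rule (2), the ROTATION `ρ_K : i ↦ i − (K+1) (mod p+q+4)` of the coordinates: it carries `Y_K`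
  to `X_{K*}` with `K* = p+q+2−K` and fixes `P = XY`, so `[CutC K] = [cube, 1/((1−X_{K*})(1−P))]`;
* rule (1b), `1 = X_{K*} + (1 − X_{K*})`: `= [CutQ K*] + [CubeZ (p+q+2)]`, i.e. `Z(b, a) + Z(a+b)`.

Together with the shuffle product (THEOREM XL, `SoloInformedShuffleProduct`) and the sum formula
(THEOREM XXXIX, `SoloInformedSumFormula`) this completes the DEPTH-TWO DOUBLE SHUFFLE RELATIONS
BETWEEN ABSTRACT PERIODS at every weight; numerical shadows follow by `evalP`.
-/

noncomputable section

open MeasureTheory Set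
open Literature.ModelTheory.ExponentialFields Literature.NumberTheory.Transcendental
open Literature.NumberTheory.Transcendental.KZ

namespace Summit.KontsevichZagierPeriods.KontsevichZagierPeriods.Theorems

variable {n : ℕ}

/-! ## 1. The rotation -/

section rot

variable (K : Fin (n + 4))

/-- The complementary cut `K* = n + 2 − K`. -/
def soloInformedCoCut : Fin (n + 4) := ⟨n + 2 - K.1, by omega⟩

/-- The value of the complementary cut. -/
theorem soloInformed_coCut_val : (soloInformedCoCut K).1 = n + 2 - K.1 := rfl

/-- The rotation `ρ_K = (· + (n + 3 − K))` of `Fin (n+4)`, i.e. `i ↦ i − (K+1) (mod n+4)`. -/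
def soloInformedRot : Equiv.Perm (Fin (n + 4)) := Equiv.addRight (⟨n + 3 - K.1, by omega⟩ : Fin (n + 4))

/-- The values of the rotation. -/
theorem soloInformed_rot_val (i : Fin (n + 4)) : (soloInformedRot K i).1 =
    if K.1 < i.1 then i.1 - (K.1 + 1) else i.1 + (n + 3 - K.1) := by
  have hi := i.2
  have hk := K.2
  simp only [soloInformedRot, Equiv.coe_addRight, Fin.val_add]
  split_ifs with h
  · rw [show i.1 + (n + 3 - K.1) = i.1 - (K.1 + 1) + (n + 4) by omega, Nat.add_mod_right]
    exact Nat.mod_eq_of_lt (by omega)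
  · exact Nat.mod_eq_of_lt (by omega)

/-- The complementary cut is again a cut. -/
theorem soloInformed_coCut_bounds (hK : 1 ≤ K.1 ∧ K.1 ≤ n + 1) :
    1 ≤ (soloInformedCoCut K).1 ∧ (soloInformedCoCut K).1 ≤ n + 1 := by
  rw [soloInformed_coCut_val]; omega

/-- The full product is invariant under the rotation. -/
theorem soloInformed_top_rot (w : Fin (n + 4) → ℝ) :
    soloInformedPrefixProd (fun i => w (soloInformedRot K i)) (Fin.last (n + 3)) =
      soloInformedPrefixProd w (Fin.last (n + 3)) := by
  unfold soloInformedPrefixProd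
  rw [Finset.filter_true_of_mem fun i _ => Fin.le_last i]
  exact Equiv.prod_comp (soloInformedRot K) w

/-- **`1/((1 − X)(1 − P)) = X/((1 − X)(1 − P)) + 1/(1 − P)`.** -/
theorem soloInformed_cut_partial_fraction' {x : Fin (n + 4) → ℝ}
    (hx : x ∈ soloInformedOpenCube (n + 4)) (L : Fin (n + 4)) :
    1 / ((1 - soloInformedPrefixProd x L) * (1 - soloInformedPrefixProd x (Fin.last (n + 3)))) =
      soloInformedCutQf L x + soloInformedCubeZf (n + 2) x := by
  have ha := (soloInformed_one_sub_prefix_pos hx L).ne'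
  have hb := (soloInformed_one_sub_prefix_pos hx (Fin.last (n + 3))).ne'
  have hz : soloInformedCubeZf (n + 2) x = 1 / (1 - soloInformedPrefixProd x (Fin.last (n + 3))) := rfl
  rw [hz, soloInformedCutQf]
  field_simp
  ring

variable (hK : 1 ≤ K.1 ∧ K.1 ≤ n + 1)

include hK in
/-- **The rotation carries the suffix product `Y_K` to the prefix product `X_{K*}`.** -/
theorem soloInformed_suffix_rot (w : Fin (n + 4) → ℝ) :
    soloInformedSuffixProd (fun i => w (soloInformedRot K i)) K =
      soloInformedPrefixProd w (soloInformedCoCut K) := by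
  unfold soloInformedSuffixProd soloInformedPrefixProd
  refine Finset.prod_equiv (soloInformedRot K) (fun i => ?_) fun i _ => rfl
  have hi := i.2
  have hk := hK.2
  simp only [Finset.mem_filter, Finset.mem_univ, true_and, Fin.lt_def, Fin.le_def,
    soloInformed_rot_val, soloInformed_coCut_val]
  split_ifs <;> omega

/-! ## 2. The rotated `CutC K` and its dissection -/

/-- The domain of the rotated `CutC K` is the cube. -/
theorem soloInformed_rotC_domain :
    ((soloInformedCutC K hK).reindex (soloInformedRot K)).domain = soloInformedOpenCube (n + 4) := by
  ext w
  change (fun i => w (soloInformedRot K i)) ∈ soloInformedOpenCube (n + 4) ↔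
    w ∈ soloInformedOpenCube (n + 4)
  exact ⟨fun h j => by simpa using h ((soloInformedRot K).symm j), fun h i => h _⟩

/-- The integrand of the rotated `CutC K` on the cube: `1/((1 − X_{K*})(1 − P)) = Q_{K*} + z`. -/
theorem soloInformed_rotC_integrand {w : Fin (n + 4) → ℝ} (hw : w ∈ soloInformedOpenCube (n + 4)) :
    ((soloInformedCutC K hK).reindex (soloInformedRot K)).integrand w =
      soloInformedCutQf (soloInformedCoCut K) w + soloInformedCubeZf (n + 2) w := by
  rw [IntegralRep.reindex_integrand, ← soloInformed_cut_partial_fraction' hw]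
  change soloInformedCutCf K (fun i => w (soloInformedRot K i)) = _
  rw [soloInformedCutCf, soloInformed_suffix_rot K hK, soloInformed_top_rot]

/-- **(2) + (1b)**: `[ρ_K · CutC K] − [CutQ K*] − [CubeZ (n+2)] ∈ relations`. -/
theorem soloInformed_rotC_move :
    of ((soloInformedCutC K hK).reindex (soloInformedRot K)) -
        of (soloInformedCutQ (soloInformedCoCut K) (soloInformed_coCut_bounds K hK)) -
      of (soloInformedCubeZ (n + 2)) ∈ relations :=
  integrandAddRel_subset_relations ⟨n + 4, _, _, soloInformedCubeZ (n + 2),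
    (soloInformed_rotC_domain K hK).symm, (soloInformed_rotC_domain K hK).symm, fun w hw => by
      rw [soloInformed_rotC_domain] at hw
      exact soloInformed_rotC_integrand K hK hw, rfl⟩

/-- **`⟦CutC K⟧ = mzvClass [K*+1, n+3−K*] + mzvClass [n+4]`.** -/
theorem soloInformed_cutC_class : toFormalPeriod (of (soloInformedCutC K hK)) =
    mzvClass [(soloInformedCoCut K).1 + 1, n + 3 - (soloInformedCoCut K).1] + mzvClass [n + 2 + 2] := by
  rw [toFormalPeriod_eq_iff.2 (of_sub_of_reindex_mem_relations (soloInformedCutC K hK)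
    (soloInformedRot K)), ← soloInformed_cutQ_class _ (soloInformed_coCut_bounds K hK),
    ← soloInformed_cubeZ_class, ← map_add, toFormalPeriod_eq_iff]
  simpa [sub_sub] using soloInformed_rotC_move K hK

end rot

/-! ## 3. The product of two cube representations, read in dimension `p+q+4` -/

section product

variable (p q : ℕ)

/-- `a + b = p + q + 4`. -/
theorem soloInformed_st_dim : p + 2 + (q + 2) = p + q + 4 := by omega

/-- The stuffle cut `K = a − 1 = p + 1` of `Fin (p+q+4)`. -/
def soloInformedStCut : Fin (p + q + 4) := ⟨p + 1, by omega⟩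

/-- The value of the stuffle cut. -/
theorem soloInformed_stCut_val : (soloInformedStCut p q).1 = p + 1 := rfl

/-- The stuffle cut is a cut. -/
theorem soloInformed_stCut_bounds : 1 ≤ (soloInformedStCut p q).1 ∧ (soloInformedStCut p q).1 ≤ p + q + 1 := by
  rw [soloInformed_stCut_val]; omega

/-- The product representation `CubeZ p × CubeZ q`, relabelled to dimension `p+q+4` (rule (2)). -/
def soloInformedStProd : IntegralRep (p + q + 4) :=
  ((soloInformedCubeZ p).prod (soloInformedCubeZ q)).reindex (finCongr (soloInformed_st_dim p q))

/-- Its domain is the cube. -/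
theorem soloInformed_stProd_domain : (soloInformedStProd p q).domain = soloInformedOpenCube (p + q + 4) := by
  ext w
  simp only [soloInformedStProd, IntegralRep.reindex_domain, IntegralRep.prod_domain,
    IntegralRep.mem_prodDomain, mem_setOf_eq]
  constructor
  · rintro ⟨ha, hb⟩ k
    obtain ⟨i, rfl⟩ := (finCongr (soloInformed_st_dim p q)).surjective k
    induction i using Fin.addCases with
    | left i => exact ha i
    | right j => exact hb j
  · exact fun hw => ⟨fun i => hw _, fun j => hw _⟩

/-- The first block's product is the prefix product `X_K`. -/
theorem soloInformed_st_prefix (w : Fin (p + q + 4) → ℝ) :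
    soloInformedPrefixProd (fun i : Fin (p + 2) => w (finCongr (soloInformed_st_dim p q)
        (Fin.castAdd (q + 2) i))) (Fin.last (p + 1)) =
      soloInformedPrefixProd w (soloInformedStCut p q) := by
  unfold soloInformedPrefixProd
  rw [Finset.filter_true_of_mem fun i _ => Fin.le_last i]
  have hinj : ∀ x ∈ (Finset.univ : Finset (Fin (p + 2))), ∀ y ∈ (Finset.univ : Finset (Fin (p + 2))),
      finCongr (soloInformed_st_dim p q) (Fin.castAdd (q + 2) x) =
        finCongr (soloInformed_st_dim p q) (Fin.castAdd (q + 2) y) → x = y := fun x _ y _ h => by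
    simpa [Fin.ext_iff] using h
  rw [← Finset.prod_image hinj]
  refine Finset.prod_congr ?_ fun _ _ => rfl
  ext k
  simp only [Finset.mem_image, Finset.mem_univ, true_and, Finset.mem_filter, Fin.le_def,
    soloInformed_stCut_val, Fin.ext_iff, finCongr_apply, Fin.val_cast, Fin.val_castAdd]
  exact ⟨fun ⟨i, hi⟩ => by omega, fun hk => ⟨⟨k.1, by omega⟩, rfl⟩⟩

/-- The second block's product is the suffix product `Y_K`. -/
theorem soloInformed_st_suffix (w : Fin (p + q + 4) → ℝ) :
    soloInformedPrefixProd (fun j : Fin (q + 2) => w (finCongr (soloInformed_st_dim p q)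
        (Fin.natAdd (p + 2) j))) (Fin.last (q + 1)) =
      soloInformedSuffixProd w (soloInformedStCut p q) := by
  unfold soloInformedPrefixProd soloInformedSuffixProd
  rw [Finset.filter_true_of_mem fun i _ => Fin.le_last i]
  have hinj : ∀ x ∈ (Finset.univ : Finset (Fin (q + 2))), ∀ y ∈ (Finset.univ : Finset (Fin (q + 2))),
      finCongr (soloInformed_st_dim p q) (Fin.natAdd (p + 2) x) =
        finCongr (soloInformed_st_dim p q) (Fin.natAdd (p + 2) y) → x = y := fun x _ y _ h => by
    simpa [Fin.ext_iff] using h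
  rw [← Finset.prod_image hinj]
  refine Finset.prod_congr ?_ fun _ _ => rfl
  ext k
  simp only [Finset.mem_image, Finset.mem_univ, true_and, Finset.mem_filter, Fin.lt_def,
    soloInformed_stCut_val, Fin.ext_iff, finCongr_apply, Fin.val_cast, Fin.val_natAdd]
  exact ⟨fun ⟨j, hj⟩ => by omega, fun hk => ⟨⟨k.1 - (p + 2), by omega⟩, by dsimp only; omega⟩⟩

/-- **The relabelled product integrand is `F_K = 1/((1 − X_K)(1 − Y_K))`.** -/
theorem soloInformed_stProd_integrand (w : Fin (p + q + 4) → ℝ) :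
    (soloInformedStProd p q).integrand w = soloInformedCutFf (soloInformedStCut p q) w := by
  simp only [soloInformedStProd, IntegralRep.reindex_integrand, IntegralRep.prod_integrand_eq,
    IntegralRep.prodFun_apply]
  change soloInformedCubeZf p _ * soloInformedCubeZf q _ = _
  rw [soloInformedCubeZf, soloInformedCubeZf, soloInformed_st_prefix, soloInformed_st_suffix,
    soloInformedCutFf, one_div_mul_one_div]

/-- **(1b)**: `[StProd] − [CutQ K] − [CutC K] ∈ relations`, `K` the stuffle cut. -/
theorem soloInformed_stProd_move :
    of (soloInformedStProd p q) -
        of (soloInformedCutQ (soloInformedStCut p q) (soloInformed_stCut_bounds p q)) -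
      of (soloInformedCutC (soloInformedStCut p q) (soloInformed_stCut_bounds p q)) ∈ relations :=
  integrandAddRel_subset_relations ⟨p + q + 4, _, _, _, (soloInformed_stProd_domain p q).symm,
    (soloInformed_stProd_domain p q).symm, fun w hw => by
      rw [soloInformed_stProd_domain] at hw
      change _ = soloInformedCutQf _ w + soloInformedCutCf _ w
      rw [soloInformed_stProd_integrand, soloInformedCutFf, soloInformedCutQf, soloInformedCutCf]
      exact soloInformed_cut_partial_fraction (soloInformed_stCut_bounds p q) hw, rfl⟩

/-! ## 4. THEOREM XLI -/

/-- **THEOREM XLI (the stuffle in `𝒫`).**  For all `a, b ≥ 2`, in `KZ.FormalPeriodRing`,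

  `Z(a) · Z(b) = Z(a, b) + Z(b, a) + Z(a + b)`,

every step being one of the three Kontsevich–Zagier rules (Fubini; (1b) twice; (2) for the
relabelling, the rotation `ρ_K` and the prefix-product chart `κ`).  No identity between real
numbers is used. -/
theorem soloInformed_mzvClass_stuffle :
    mzvClass [p + 2] * mzvClass [q + 2] =
      mzvClass [p + 2, q + 2] + mzvClass [q + 2, p + 2] + mzvClass [p + q + 4] := by
  have hK := soloInformed_stCut_bounds p q
  have h1 : toFormalPeriod (of (soloInformedStProd p q)) = mzvClass [p + 2] * mzvClass [q + 2] := by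
    rw [← soloInformed_cubeZ_class, ← soloInformed_cubeZ_class, ← map_mul, of_mul_of, eq_comm,
      toFormalPeriod_eq_iff]
    exact of_sub_of_reindex_mem_relations _ _
  have h2 : toFormalPeriod (of (soloInformedStProd p q)) =
      toFormalPeriod (of (soloInformedCutQ (soloInformedStCut p q) hK)) +
        toFormalPeriod (of (soloInformedCutC (soloInformedStCut p q) hK)) := by
    rw [← map_add, toFormalPeriod_eq_iff]
    simpa [sub_sub] using soloInformed_stProd_move p q
  have hQ : toFormalPeriod (of (soloInformedCutQ (soloInformedStCut p q) hK)) = mzvClass [p + 2, q + 2] := by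
    rw [soloInformed_cutQ_class, soloInformed_stCut_val, show p + q + 3 - (p + 1) = q + 2 by omega]
  have hC : toFormalPeriod (of (soloInformedCutC (soloInformedStCut p q) hK)) =
      mzvClass [q + 2, p + 2] + mzvClass [p + q + 4] := by
    rw [soloInformed_cutC_class, soloInformed_coCut_val, soloInformed_stCut_val,
      show p + q + 2 - (p + 1) + 1 = q + 2 by omega,
      show p + q + 3 - (p + q + 2 - (p + 1)) = p + 2 by omega]
  rw [← h1, h2, hQ, hC, ← add_assoc]

/-- **THEOREM XLI, numerically**: `ζ(a)ζ(b) = ζ(a,b) + ζ(b,a) + ζ(a+b)` for `a, b ≥ 2`, as the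
`evalP`-shadow of the identity in `𝒫`. -/
theorem soloInformed_multipleZeta_stuffle :
    multipleZeta [p + 2] * multipleZeta [q + 2] =
      multipleZeta [p + 2, q + 2] + multipleZeta [q + 2, p + 2] + multipleZeta [p + q + 4] := by
  have h := congrArg evalP (soloInformed_mzvClass_stuffle p q)
  simp only [map_mul, map_add,
    evalP_mzvClass (show MZV.IsAdmissible [p + 2] from ⟨fun i hi => by simp at hi; omega, fun _ => by simp⟩),
    evalP_mzvClass (show MZV.IsAdmissible [q + 2] from ⟨fun i hi => by simp at hi; omega, fun _ => by simp⟩),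
    evalP_mzvClass (show MZV.IsAdmissible [p + 2, q + 2] from
      ⟨fun i hi => by simp at hi; omega, fun _ => by simp⟩),
    evalP_mzvClass (show MZV.IsAdmissible [q + 2, p + 2] from
      ⟨fun i hi => by simp at hi; omega, fun _ => by simp⟩),
    evalP_mzvClass (show MZV.IsAdmissible [p + q + 4] from
      ⟨fun i hi => by simp at hi; omega, fun _ => by simp⟩)] at h
  exact h

/-- **COROLLARY (depth-two double shuffle in `𝒫`)**: comparing THEOREM XL (shuffle) with
THEOREM XLI (stuffle) for the same pair,
`∑_{σ shuffle} Z(a+b−M_σ, M_σ) = Z(a,b) + Z(b,a) + Z(a+b)` in `KZ.FormalPeriodRing`. -/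
theorem soloInformed_mzvClass_doubleShuffle :
    ∑ σ ∈ Finset.univ.filter (soloInformedCompat (soloInformedShPoset p q)),
        mzvClass [p + q + 4 - soloInformedShM σ, soloInformedShM σ] =
      mzvClass [p + 2, q + 2] + mzvClass [q + 2, p + 2] + mzvClass [p + q + 4] := by
  rw [← soloInformed_mzvClass_shuffle, soloInformed_mzvClass_stuffle]

/-- **Weight five in `𝒫`**: `6 Z(4,1) + 2 Z(3,2) = Z(5)` — the double shuffle of `ζ(2)ζ(3)`
(`6Z(4,1) + 3Z(3,2) + Z(2,3) = Z(2,3) + Z(3,2) + Z(5)`), an identity between abstract periods. -/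
theorem soloInformed_mzvClass_weight5_ds :
    6 • mzvClass [4, 1] + 2 • mzvClass [3, 2] = mzvClass [5] := by
  have h := soloInformed_mzvClass_stuffle 0 1
  rw [soloInformed_mzvClass_shuffle_two_three] at h
  have h' : 6 • mzvClass [4, 1] + 2 • mzvClass [3, 2] + (mzvClass [3, 2] + mzvClass [2, 3]) =
      mzvClass [5] + (mzvClass [3, 2] + mzvClass [2, 3]) := by
    calc 6 • mzvClass [4, 1] + 2 • mzvClass [3, 2] + (mzvClass [3, 2] + mzvClass [2, 3])
        = 6 • mzvClass [4, 1] + 3 • mzvClass [3, 2] + mzvClass [2, 3] := by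
          simp only [succ_nsmul]; abel
      _ = mzvClass [0 + 1 + 4] + (mzvClass [3, 2] + mzvClass [2, 3]) := by
          rw [h]; abel
      _ = mzvClass [5] + (mzvClass [3, 2] + mzvClass [2, 3]) := rfl
  exact add_right_cancel h'

end product

end Summit.KontsevichZagierPeriods.KontsevichZagierPeriods.Theorems
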